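import Summits.CriticalPhenomena.PercolationContinuityZ3.Theorems.PercNearOneGluingNoHeavyLowerTailSahiThreeCopyTwoPointCertsK5Table

/-!
# Sahi's three-function conjecture — `k = 5` certificate checks, entries 2271–2510

COMPUTATIONAL (`native_decide`, integer arithmetic): the flow-form / face-form certificates of `certTable5` (`…TwoPointCertsK5Table`,
data `…TwoPointCertsK5Data*`) pass `checkEntry5` for the entries 2271 ≤ j < 2511 (chunks of 60).  Seat `prim-sahi-p1`, generation 61;
`--supports stmt-CriticalPhenomena-4575`. [this work]
-/

namespace Summit.CriticalPhenomena.PercolationContinuityZ3.Theorems.SahiThreeCopy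

/-- ★★ The certificates of `certTable5` pass the exact check — entries 2271–2330 (by evaluation). [this work] -/
theorem checkChunk5_2271 : checkChunk5 certTable5 upList5 (upSetsC 4) arrTab5 2271 60 = true := by
  native_decide

/-- ★★ The certificates of `certTable5` pass the exact check — entries 2331–2390 (by evaluation). [this work] -/
theorem checkChunk5_2331 : checkChunk5 certTable5 upList5 (upSetsC 4) arrTab5 2331 60 = true := by
  native_decide

/-- ★★ The certificates of `certTable5` pass the exact check — entries 2391–2450 (by evaluation). [this work] -/
theorem checkChunk5_2391 : checkChunk5 certTable5 upList5 (upSetsC 4) arrTab5 2391 60 = true := by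
  native_decide

/-- ★★ The certificates of `certTable5` pass the exact check — entries 2451–2510 (by evaluation). [this work] -/
theorem checkChunk5_2451 : checkChunk5 certTable5 upList5 (upSetsC 4) arrTab5 2451 60 = true := by
  native_decide


end Summit.CriticalPhenomena.PercolationContinuityZ3.Theorems.SahiThreeCopy
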